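import Mathlib
import Literature.Computability.AlgebraicComplexity.FSS14RankConcentration
import HarnessLib

/-!
# FSV 2018 Lemma 40 = Forbes–Saptharishi–Shpilka 2014, Thm. 28 (STOC Thm. 4.1): rank concentration
# of commutative roABPs after the shift by an independent monomial map — discharge of `FSV2018_lemma40`

M. Forbes, A. Shpilka, B. L. Volk, *Succinct hitting sets and barriers to proving lower bounds for
algebraic circuits*, Theory Comput. 14 (2018) = arXiv:1701.05328, Lemma 40 (seq.) = ToC Lemma 5.16
[ForbesShpilkaVolk2018], quoting M. Forbes, R. Saptharishi, A. Shpilka, arXiv:1309.5668, Thm. 28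
[ForbesSaptharishiShpilka2014] (locator: paper:arxiv-1309.5668 p0017.txt:L8–L30). The tree's named
fact `FSV2018_lemma40` (`FSV18SuccinctGenerators.lean`) is PROVED here (`FSV2018_lemma40_holds`)
following the printed proof of [FSS14, Thm. 28]:

* "As `F` is computable by a width-`r` commutative ROABP, we can express it as
  `F(x) = F(y,z) = G(y) · H(z)`" — `exists_split_of_isCommROABPMatrix` (order the variables with
  `y` first; the layers are univariate of degree `≤ d` in distinct variables, so `G` has individual
  degree `≤ d` in the variables `y`: `prod_layers_support`).
* "By bilinearity of matrix multiplication, `∂_x^a(F) = ∂_y^b(G) · ∂_z^c(H)`" — after the shift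
  `x ↦ x + g`, the coefficient matrix of `x^{b+c}` in `F(x+g)` is the product of the coefficient
  matrices of `y^b` in `G(y+g)` and `z^c` in `H(z+g)` (`coeff_mul_of_disjoint_vars`).
* "it follows from Cor. 27 that `G(y)` has support-`⌈lg r²⌉` rank concentration" —
  `FSS2014.isRankConcentrated_of_isIndepMonomialMap` (file `FSS14RankConcentration`) applied to the
  `r² ≤ 2^{⌈lg r²⌉}` entries of `G` in the `⌈lg r²⌉ + 1` variables `y`.
* "Applying this argument repeatedly (each time with a new partition) yields the claim" — strong
  induction on `|supp a|` (`isRankConcentrated_of_isCommROABPMatrix`, over any field containing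
  `𝔽[t,s]`; `FSV2018_lemma40_holds` is the instance `𝔽(t,s)`).

No new definitions, no named facts (net debt −1); nothing here bears on `VP ≠ VNP`.

## References
* [ForbesShpilkaVolk2018] arXiv:1701.05328, Lemma 40 (seq.) = ToC Lemma 5.16, p. 28
  (locator: paper:arxiv-1701.05328 p0020.txt:L26).
* [ForbesSaptharishiShpilka2014] arXiv:1309.5668, Thm. 28 and its proof
  (locator: paper:arxiv-1309.5668 p0017.txt:L8–L30).
-/

noncomputable section

open MvPolynomial Finset Matrix

open scoped BigOperators

namespace Literature.Computability.AlgebraicComplexity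

namespace FSS2014

/-! ### Layers of an roABP: univariate matrices of degree `≤ d` in distinct variables -/

section Layers

variable {F : Type*} [CommRing F] {ι : Type*} [DecidableEq ι] {w : ℕ}

/-- The monomials of a univariate layer entry `p(x_i)` (`deg p ≤ d`) are powers `x_i^e`, `e ≤ d`.
[cite: ForbesShpilkaVolk2018, §5.3 (definition of roABP, seq. p. 19–20) = ToC §5.3, p. 27] -/
theorem support_aeval_X_univariate (i : ι) (p : Polynomial F) {d : ℕ} (hp : p.natDegree ≤ d) :
    ∀ m ∈ (Polynomial.aeval (X i : MvPolynomial ι F) p).support,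
      m.support ⊆ {i} ∧ ∀ k, m k ≤ d := by
  intro m hm
  rw [Polynomial.aeval_eq_sum_range] at hm
  obtain ⟨e, he, hm⟩ := mem_biUnion.1 (MvPolynomial.support_sum hm)
  rw [X_pow_eq_monomial, smul_monomial] at hm
  have hme : m = Finsupp.single i e := mem_singleton.1 (support_monomial_subset hm)
  subst hme
  refine ⟨Finsupp.support_single_subset, fun k => ?_⟩
  rw [Finsupp.single_apply]
  split_ifs
  · exact (Nat.lt_succ_iff.1 (mem_range.1 he)).trans hp
  · exact Nat.zero_le _

/-- Multiplying a polynomial of individual degree `≤ d` in the variables `T` by a univariate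
polynomial of degree `≤ d` in a fresh variable `x ∉ T` gives individual degree `≤ d` in `T ∪ {x}`.
[cite: ForbesSaptharishiShpilka2014, Thm. 28 (proof)] locator: paper:arxiv-1309.5668 p0017.txt:L13 -/
theorem support_mul_univariate {d : ℕ} {T T' : Finset ι} {x : ι} (q l : MvPolynomial ι F)
    (hq : ∀ mo ∈ q.support, mo.support ⊆ T ∧ ∀ i, mo i ≤ d)
    (hl : ∀ mo ∈ l.support, mo.support ⊆ {x} ∧ ∀ i, mo i ≤ d)
    (hxT : x ∉ T) (hTT' : T ⊆ T') (hxT' : x ∈ T') :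
    ∀ mo ∈ (q * l).support, mo.support ⊆ T' ∧ ∀ i, mo i ≤ d := by
  intro mo hmo
  obtain ⟨b, hb, c, hc, hbc⟩ := Finset.mem_add.1 (support_mul q l hmo)
  subst hbc
  obtain ⟨hbT, hbd⟩ := hq b hb
  obtain ⟨hcx, hcd⟩ := hl c hc
  refine ⟨?_, fun i => ?_⟩
  · intro i hi
    rcases mem_union.1 (Finsupp.support_add hi) with h | h
    · exact hTT' (hbT h)
    · rw [mem_singleton.1 (hcx h)]; exact hxT'
  · rw [Finsupp.add_apply]
    by_cases hix : i = x
    · subst hix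
      have : b i = 0 := Finsupp.notMem_support_iff.1 fun h => hxT (hbT h)
      rw [this, zero_add]; exact hcd i
    · have : c i = 0 := Finsupp.notMem_support_iff.1 fun h => hix (mem_singleton.1 (hcx h))
      rw [this, add_zero]; exact hbd i

/-- **The product of the layers of an roABP reading distinct variables has individual degree `≤ d`
in those variables** ("`G ∈ 𝔽[y]^{r×r}` … of individual degree `< d`"): every monomial `b` of every
entry of `L₀ ⋯ L_{m-1}` has `supp b ⊆ {x(0), …, x(m-1)}` and `b ≤ d` pointwise.
[cite: ForbesSaptharishiShpilka2014, Thm. 28 (proof)] locator: paper:arxiv-1309.5668 p0017.txt:L13 -/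
theorem prod_layers_support {m d : ℕ} (L : Fin m → Matrix (Fin w) (Fin w) (MvPolynomial ι F))
    (x : Fin m → ι) (hx : Function.Injective x)
    (hL : ∀ k a b, ∀ mo ∈ (L k a b).support, mo.support ⊆ {x k} ∧ ∀ i, mo i ≤ d) :
    ∀ a b, ∀ mo ∈ ((List.ofFn L).prod a b).support,
      mo.support ⊆ univ.image x ∧ ∀ i, mo i ≤ d := by
  induction m with
  | zero =>
    intro a b mo hmo
    rw [List.ofFn_zero, List.prod_nil, Matrix.one_apply] at hmo
    split_ifs at hmo
    · have : mo = 0 := by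
        have h1 := support_monomial_subset (s := (0 : ι →₀ ℕ)) (a := (1 : F))
          (by rwa [monomial_zero', C_1])
        exact mem_singleton.1 h1
      subst this
      simp
    · simp at hmo
  | succ m ih =>
    intro a b mo hmo
    rw [List.ofFn_succ', List.concat_eq_append, List.prod_append, List.prod_singleton,
      Matrix.mul_apply] at hmo
    obtain ⟨j, -, hj⟩ := mem_biUnion.1 (MvPolynomial.support_sum hmo)
    have hinj' : Function.Injective (x ∘ Fin.castSucc) := hx.comp (Fin.castSucc_injective m)
    have ih' := ih (fun k => L (Fin.castSucc k)) (x ∘ Fin.castSucc) hinj'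
      (fun k a' b' => hL (Fin.castSucc k) a' b') a j
    refine support_mul_univariate _ _ ih' (hL (Fin.last m) j b) ?_ ?_ ?_ mo hj
    · intro hmem
      obtain ⟨k, -, hk⟩ := mem_image.1 hmem
      exact Fin.castSucc_ne_last k (hx hk)
    · intro i hi
      obtain ⟨k, -, hk⟩ := mem_image.1 hi
      exact mem_image.2 ⟨Fin.castSucc k, mem_univ _, hk⟩
    · exact mem_image.2 ⟨Fin.last m, mem_univ _, rfl⟩

end Layers

/-! ### "F(x) = G(y) · H(z)": splitting a commutative roABP along a set of variables -/

section Split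

variable {F : Type*} [CommRing F] {ι : Type*} [Fintype ι] [DecidableEq ι] {w d : ℕ}

/-- **[FSS14, Thm. 28, proof]: "As `F` is computable by a width-`r` commutative ROABP, we can
express it then as `F(x) = F(y,z) = G(y) · H(z)`, for `G ∈ 𝔽[y]^{r×r}` and `H ∈ 𝔽[z]^{r×r}`. This
is where we use the commutativity of the ROABP."** For every set `y` of variables, a matrix
computed by width-`w` roABPs in every order (`IsCommROABPMatrix`) factors as `G · H` with the
entries of `G` of individual degree `≤ d` in the variables `y` and the entries of `H` in the
remaining variables: take the order listing `y` first.
[cite: ForbesSaptharishiShpilka2014, Thm. 28 (proof)] locator: paper:arxiv-1309.5668 p0017.txt:L13 -/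
theorem exists_split_of_isCommROABPMatrix {Fm : Matrix (Fin w) (Fin w) (MvPolynomial ι F)}
    (h : IsCommROABPMatrix F w d Fm) (y : Finset ι) :
    ∃ G H : Matrix (Fin w) (Fin w) (MvPolynomial ι F), Fm = G * H ∧
      (∀ a b, ∀ mo ∈ (G a b).support, mo.support ⊆ y ∧ ∀ i, mo i ≤ d) ∧
      (∀ a b, ∀ mo ∈ (H a b).support, mo.support ⊆ yᶜ) := by
  classical
  -- the order: `y` first (via `Fin |y| ≃ y`), then the complement
  set ey : Fin y.card ≃ {i // i ∈ y} := y.equivFin.symm with hey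
  set ez : Fin yᶜ.card ≃ {i // i ∉ y} :=
    yᶜ.equivFin.symm.trans (Equiv.subtypeEquivRight fun i => by rw [mem_compl]) with hez
  set π : Fin (y.card + yᶜ.card) ≃ ι :=
    finSumFinEquiv.symm.trans ((ey.sumCongr ez).trans (Equiv.sumCompl fun i => i ∈ y)) with hπ
  have hπl : ∀ k : Fin y.card, π (Fin.castAdd _ k) = (ey k : ι) := by
    intro k
    rw [hπ, Equiv.trans_apply, finSumFinEquiv_symm_apply_castAdd, Equiv.trans_apply,
      Equiv.sumCongr_apply, Sum.map_inl, Equiv.sumCompl_apply_inl]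
  have hπr : ∀ k : Fin yᶜ.card, π (Fin.natAdd _ k) = (ez k : ι) := by
    intro k
    rw [hπ, Equiv.trans_apply, finSumFinEquiv_symm_apply_natAdd, Equiv.trans_apply,
      Equiv.sumCongr_apply, Sum.map_inr, Equiv.sumCompl_apply_inr]
  obtain ⟨M, hM, hFm⟩ := h _ π
  refine ⟨(List.ofFn fun k : Fin y.card => M (Fin.castAdd _ k)).prod,
    (List.ofFn fun k : Fin yᶜ.card => M (Fin.natAdd _ k)).prod, ?_, ?_, ?_⟩
  · rw [hFm, List.ofFn_add, List.prod_append]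
    rfl
  · -- `G`: layers in the distinct variables `ey k ∈ y`
    have hlay : ∀ (k : Fin y.card) a b, ∀ mo ∈ (M (Fin.castAdd _ k) a b).support,
        mo.support ⊆ {(ey k : ι)} ∧ ∀ i, mo i ≤ d := by
      intro k a b
      obtain ⟨p, hp, hpe⟩ := hM (Fin.castAdd _ k) a b
      rw [hpe, hπl]
      exact support_aeval_X_univariate _ p hp
    have hinj : Function.Injective fun k : Fin y.card => (ey k : ι) :=
      fun k k' hk => ey.injective (Subtype.ext hk)
    intro a b mo hmo
    obtain ⟨hsub, hdeg⟩ := prod_layers_support _ _ hinj hlay a b mo hmo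
    refine ⟨fun i hi => ?_, hdeg⟩
    obtain ⟨k, -, hk⟩ := mem_image.1 (hsub hi)
    rw [← hk]; exact (ey k).2
  · -- `H`: layers in the variables `ez k ∉ y`
    have hlay : ∀ (k : Fin yᶜ.card) a b, ∀ mo ∈ (M (Fin.natAdd _ k) a b).support,
        mo.support ⊆ {(ez k : ι)} ∧ ∀ i, mo i ≤ d := by
      intro k a b
      obtain ⟨p, hp, hpe⟩ := hM (Fin.natAdd _ k) a b
      rw [hpe, hπr]
      exact support_aeval_X_univariate _ p hp
    have hinj : Function.Injective fun k : Fin yᶜ.card => (ez k : ι) :=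
      fun k k' hk => ez.injective (Subtype.ext hk)
    intro a b mo hmo
    obtain ⟨hsub, -⟩ := prod_layers_support _ _ hinj hlay a b mo hmo
    intro i hi
    obtain ⟨k, -, hk⟩ := mem_image.1 (hsub hi)
    rw [← hk, mem_compl]; exact (ez k).2

end Split

/-! ### "∂_x^a(F) = ∂_y^b(G) · ∂_z^c(H)": coefficients of products of variable-disjoint factors -/

section Disjoint

variable {R : Type*} [CommSemiring R] {ι : Type*} [DecidableEq ι]

/-- Coefficients of a product `P(y) · Q(z)` of polynomials in disjoint sets of variables:
`coeff_{y^b z^c}(P Q) = coeff_{y^b}(P) · coeff_{z^c}(Q)` ("by bilinearity of matrix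
multiplication, we can factor the derivative as `∂_x^a(F) = ∂_y^b(G) · ∂_z^c(H)`").
[cite: ForbesSaptharishiShpilka2014, Thm. 28 (proof)] locator: paper:arxiv-1309.5668 p0017.txt:L13–L14 -/
theorem coeff_mul_of_disjoint_vars (y : Finset ι) (P Q : MvPolynomial ι R)
    (hP : ∀ b ∈ P.support, b.support ⊆ y) (hQ : ∀ c ∈ Q.support, ∀ i ∈ c.support, i ∉ y)
    (a : ι →₀ ℕ) :
    coeff a (P * Q) = coeff (a.filter (· ∈ y)) P * coeff (a.filter fun i => ¬ i ∈ y) Q := by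
  rw [coeff_mul]
  have hmem : (a.filter (· ∈ y), a.filter fun i => ¬ i ∈ y) ∈ antidiagonal a := by
    rw [HasAntidiagonal.mem_antidiagonal, Finsupp.filter_add_filter_not]
  rw [sum_eq_single _ ?_ (fun hn => (hn hmem).elim)]
  rintro ⟨b, c⟩ hbc hne
  rw [HasAntidiagonal.mem_antidiagonal] at hbc
  dsimp only at hbc ⊢
  by_contra hprod
  have hb : b ∈ P.support := mem_support_iff.2 fun h0 => hprod (by rw [h0, zero_mul])
  have hc : c ∈ Q.support := mem_support_iff.2 fun h0 => hprod (by rw [h0, mul_zero])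
  apply hne
  have key : ∀ i, (i ∈ y → c i = 0) ∧ (i ∉ y → b i = 0) := fun i =>
    ⟨fun hi => Finsupp.notMem_support_iff.1 fun hic => hQ c hc i hic hi,
     fun hi => Finsupp.notMem_support_iff.1 fun hib => hi (hP b hb hib)⟩
  refine Prod.ext ?_ ?_ <;> dsimp only <;> ext i <;> rw [Finsupp.filter_apply] <;>
    have hai := congrArg (fun f : ι →₀ ℕ => f i) hbc <;>
    simp only [Finsupp.add_apply] at hai <;> split_ifs with hi
  · rw [← hai, (key i).1 hi, add_zero]
  · exact (key i).2 hi
  · exact (key i).1 hi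
  · rw [← hai, (key i).2 hi, zero_add]

variable [Fintype ι]

/-- The shift `x ↦ x + v` does not introduce variables: if every monomial of `P` is supported in
`T`, so is every monomial of `P(x + v)` (the transfer matrix is triangular: `T_{a,b} = 0` unless
`a ≤ b`). [cite: ForbesSaptharishiShpilka2014, Construction 19] locator: paper:arxiv-1309.5668 p0014.txt:L44–L46 -/
theorem support_aeval_X_add_C_subset (v : ι → R) (P : MvPolynomial ι R) (T : Finset ι)
    (hP : ∀ b ∈ P.support, b.support ⊆ T) :
    ∀ a ∈ (aeval (fun i => X i + C (v i)) P).support, a.support ⊆ T := by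
  intro a ha
  rw [mem_support_iff, coeff_aeval_X_add_C] at ha
  obtain ⟨b, hb, hne⟩ := exists_ne_zero_of_sum_ne_zero ha
  have hab : a ≤ b := by
    by_contra h
    rw [shiftWt_eq, mchoose_eq_zero_of_not_le h, Nat.cast_zero, zero_mul, mul_zero] at hne
    exact hne rfl
  exact (Finsupp.support_mono hab).trans (hP b hb)

end Disjoint

/-! ### Theorem 28: support-`⌈lg w²⌉` rank concentration of commutative roABPs -/

section Main

variable {F : Type*} [Field F] {ι τ τ' : Type*} [Fintype ι] [DecidableEq ι] {w d : ℕ}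

/-- **[FSS14, Thm. 28] = FSV Lemma 40, over any field containing `𝔽[t,s]`:** "Let
`F(x) ∈ 𝔽[x]^{r×r}` be of individual degree `< d`, and be computed by a width-`r` commutative
ROABP. Let `g(t,s)` be an individual degree `< d`, `(⌈lg r²⌉+1)`-wise independent monomial map.
Then, `F(x)` has support-`⌈lg r²⌉` rank concentration at `g(t,s)` over the field `𝔽(t,s)`."
Proof as printed: for `|supp a| > ⌈lg w²⌉` split off `⌈lg w²⌉ + 1` variables `y` of the support,
factor `F = G(y) H(z)`, apply Cor. 27 to `G` and push the resulting span relation through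
multiplication by the coefficient matrix of `H`; induct on `|supp a|`.
[cite: ForbesSaptharishiShpilka2014, Thm. 28] locator: paper:arxiv-1309.5668 p0017.txt:L8–L30 -/
theorem isRankConcentrated_of_isCommROABPMatrix (K : Type*) [Field K]
    [Algebra (MvPolynomial (τ ⊕ τ') F) K]
    (hinj : Function.Injective (algebraMap (MvPolynomial (τ ⊕ τ') F) K))
    (Fm : Matrix (Fin w) (Fin w) (MvPolynomial ι F)) (g : ι → MvPolynomial (τ ⊕ τ') F)
    (hro : IsCommROABPMatrix F w d Fm) (hg : IsIndepMonomialMap F d (Nat.clog 2 (w ^ 2) + 1) g) :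
    IsRankConcentrated (K := K) (Nat.clog 2 (w ^ 2))
      (fun j : Fin w × Fin w =>
        MvPolynomial.map ((algebraMap (MvPolynomial (τ ⊕ τ') F) K).comp C) (Fm j.1 j.2))
      (fun i => algebraMap (MvPolynomial (τ ⊕ τ') F) K (g i)) := by
  classical
  set ℓ := Nat.clog 2 (w ^ 2) with hℓ
  set φ := algebraMap (MvPolynomial (τ ⊕ τ') F) K with hφ
  set vK : ι → K := fun i => φ (g i) with hvK
  -- the shift over `K` and the rows of a matrix of polynomials
  set Sh : MvPolynomial ι K → MvPolynomial ι K :=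
    fun P => aeval (fun i => (X i + C (vK i) : MvPolynomial ι K)) P with hSh
  set row : Matrix (Fin w) (Fin w) (MvPolynomial ι F) → (ι →₀ ℕ) → (Fin w × Fin w) → K :=
    fun A a j => coeff a (Sh (MvPolynomial.map (φ.comp C) (A j.1 j.2))) with hrow
  unfold IsRankConcentrated
  change Submodule.span K (Set.range fun a : {a : ι →₀ ℕ // a.support.card ≤ ℓ} => row Fm a.1) =
    Submodule.span K (Set.range (row Fm))
  set Vs := Submodule.span K (Set.range fun a : {a : ι →₀ ℕ // a.support.card ≤ ℓ} => row Fm a.1)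
    with hVs
  -- it suffices that every row lies in the span of the small-support rows
  suffices hall : ∀ n (a : ι →₀ ℕ), a.support.card ≤ n → row Fm a ∈ Vs by
    refine le_antisymm (Submodule.span_mono ?_) (Submodule.span_le.2 ?_)
    · rintro _ ⟨a, rfl⟩; exact ⟨a.1, rfl⟩
    · rintro _ ⟨a, rfl⟩; exact hall _ a le_rfl
  intro n
  induction n with
  | zero =>
    intro a ha
    exact Submodule.subset_span ⟨⟨a, ha.trans (Nat.zero_le _)⟩, rfl⟩
  | succ n ih =>
    intro a ha
    by_cases hsmall : a.support.card ≤ ℓ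
    · exact Submodule.subset_span ⟨⟨a, hsmall⟩, rfl⟩
    -- split off `ℓ + 1` variables `y` of the support and factor `F = G(y) · H(z)`
    have hbig : ℓ + 1 ≤ a.support.card := by omega
    obtain ⟨y, hysub, hycard⟩ := exists_subset_card_eq hbig
    obtain ⟨G, H, hGH, hG, hH⟩ := exists_split_of_isCommROABPMatrix hro y
    have hH' : ∀ a' b', ∀ c ∈ (H a' b').support, ∀ i ∈ c.support, i ∉ y :=
      fun a' b' c hc i hi => mem_compl.1 (hH a' b' c hc hi)
    -- supports after base change and shift
    have hGK : ∀ a' b', ∀ b ∈ (Sh (MvPolynomial.map (φ.comp C) (G a' b'))).support, b.support ⊆ y :=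
      fun a' b' => support_aeval_X_add_C_subset vK _ y
        (fun b hb => (hG a' b' b (support_map_subset _ _ hb)).1)
    have hHK : ∀ a' b', ∀ c ∈ (Sh (MvPolynomial.map (φ.comp C) (H a' b'))).support,
        ∀ i ∈ c.support, i ∉ y := by
      intro a' b' c hc i hi
      have := support_aeval_X_add_C_subset vK _ yᶜ
        (fun c' hc' => hH a' b' c' (support_map_subset _ _ hc')) c hc
      exact mem_compl.1 (this hi)
    -- "∂_x^{b+c}(F) = ∂_y^b(G) · ∂_z^c(H)" for `supp b ⊆ y`, `supp c ∩ y = ∅`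
    have hprod : ∀ b c : ι →₀ ℕ, b.support ⊆ y → (∀ i ∈ c.support, i ∉ y) →
        row Fm (b + c) = fun j => ∑ k, row G b (j.1, k) * row H c (k, j.2) := by
      intro b c hb hc
      have hfy : (b + c).filter (· ∈ y) = b := by
        rw [Finsupp.filter_add, (Finsupp.filter_eq_self_iff _ _).2 (fun i hi => hb
          (Finsupp.mem_support_iff.2 hi)), (Finsupp.filter_eq_zero_iff _ _).2 (fun i hi =>
          Finsupp.notMem_support_iff.1 fun h => hc i h hi), add_zero]
      have hfz : (b + c).filter (fun i => ¬ i ∈ y) = c := by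
        rw [Finsupp.filter_add, (Finsupp.filter_eq_zero_iff _ _).2 (fun i hi =>
          Finsupp.notMem_support_iff.1 fun h => hi (hb h)), (Finsupp.filter_eq_self_iff _ _).2
          (fun i hi => hc i (Finsupp.mem_support_iff.2 hi)), zero_add]
      funext j
      rw [hrow]
      dsimp only
      rw [hGH, Matrix.mul_apply, map_sum, hSh]
      dsimp only
      rw [map_sum, coeff_sum]
      refine sum_congr rfl fun k _ => ?_
      rw [map_mul, map_mul, coeff_mul_of_disjoint_vars y _ _ (hGK j.1 k) (hHK k j.2), hfy, hfz]
    -- Cor. 27 for `G`: `w²` polynomials of individual degree `≤ d` in the `ℓ + 1` variables `y`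
    have hρ : Fintype.card (Fin w × Fin w) ≤ 2 ^ ℓ := by
      rw [Fintype.card_prod, Fintype.card_fin, ← sq, hℓ]
      exact Nat.le_pow_clog one_lt_two _
    have hconc := isRankConcentrated_of_isIndepMonomialMap K hinj d ℓ (ℓ + 1) y hycard.le hρ
      (fun j : Fin w × Fin w => G j.1 j.2) (fun j b hb => hG j.1 j.2 b hb) g hg
    unfold IsRankConcentrated at hconc
    change Submodule.span K (Set.range fun b : {b : ι →₀ ℕ // b.support.card ≤ ℓ} => row G b.1) =
      Submodule.span K (Set.range (row G)) at hconc
    -- the two halves of `a`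
    set b₀ := a.filter (· ∈ y) with hb₀
    set c₀ := a.filter (fun i => ¬ i ∈ y) with hc₀
    have hb₀y : b₀.support ⊆ y := fun i hi => by
      rw [hb₀, Finsupp.support_filter, mem_filter] at hi; exact hi.2
    have hc₀y : ∀ i ∈ c₀.support, i ∉ y := fun i hi => by
      rw [hc₀, Finsupp.support_filter, mem_filter] at hi; exact hi.2
    have ha₀ : a = b₀ + c₀ := by rw [hb₀, hc₀, Finsupp.filter_add_filter_not]
    have hc₀card : c₀.support.card + (ℓ + 1) = a.support.card := by
      have h1 : c₀.support = a.support \ y := by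
        rw [hc₀, Finsupp.support_filter, sdiff_eq_filter]
      rw [h1, card_sdiff_of_subset hysub, hycard]
      omega
    -- multiplication by the coefficient matrix of `H` at `c₀`, a linear map
    set Φ : ((Fin w × Fin w) → K) →ₗ[K] ((Fin w × Fin w) → K) :=
      { toFun := fun m j => ∑ k, m (j.1, k) * row H c₀ (k, j.2)
        map_add' := fun m m' => by
          funext j; simp only [Pi.add_apply, add_mul, sum_add_distrib]
        map_smul' := fun r m => by
          funext j; simp only [Pi.smul_apply, smul_eq_mul, RingHom.id_apply, mul_sum, mul_assoc] }
      with hΦ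
    have hΦrow : ∀ b : ι →₀ ℕ, b.support ⊆ y → Φ (row G b) = row Fm (b + c₀) := by
      intro b hb
      rw [hprod b c₀ hb hc₀y]
      rfl
    -- rows of `G` at exponents not supported in `y` vanish
    have hGzero : ∀ b : ι →₀ ℕ, ¬ b.support ⊆ y → row G b = 0 := by
      intro b hb
      funext j
      rw [hrow, Pi.zero_apply]
      dsimp only
      rw [← notMem_support_iff]
      exact fun hmem => hb (hGK j.1 j.2 b hmem)
    -- the small-support rows of `G` are mapped into `Vs`
    have hsmallG : Submodule.span K (Set.range fun b : {b : ι →₀ ℕ // b.support.card ≤ ℓ} =>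
        row G b.1) ≤ Vs.comap Φ := by
      rw [Submodule.span_le]
      rintro _ ⟨b, rfl⟩
      rw [SetLike.mem_coe, Submodule.mem_comap]
      change Φ (row G b.1) ∈ Vs
      by_cases hby : b.1.support ⊆ y
      · rw [hΦrow b.1 hby]
        refine ih (b.1 + c₀) ?_
        calc (b.1 + c₀).support.card ≤ (b.1.support ∪ c₀.support).card :=
              card_le_card Finsupp.support_add
          _ ≤ b.1.support.card + c₀.support.card := card_union_le _ _
          _ ≤ n := by have := b.2; omega
      · rw [hGzero b.1 hby, map_zero]
        exact Submodule.zero_mem _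
    -- conclusion for `a = b₀ + c₀`
    have hGb₀ : row G b₀ ∈ Submodule.span K
        (Set.range fun b : {b : ι →₀ ℕ // b.support.card ≤ ℓ} => row G b.1) := by
      rw [hconc]
      exact Submodule.subset_span ⟨b₀, rfl⟩
    have := hsmallG hGb₀
    rw [Submodule.mem_comap, hΦrow b₀ hb₀y, ← ha₀] at this
    exact this

end Main

end FSS2014

/-- **FSV Lemma 40 (ToC Lemma 5.16) = [FSS14, Thm. 28] — DISCHARGED.** The named fact
`FSV2018_lemma40` of `FSV18SuccinctGenerators.lean` (rank concentration of commutative roABP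
matrices after the shift by an individual-degree-`d`, `(⌈log₂ w²⌉+1)`-wise independent monomial
map, over `𝔽(t,s)`) holds: `FSS2014.isRankConcentrated_of_isCommROABPMatrix` at `K = 𝔽(t,s)`.
[cite: ForbesShpilkaVolk2018, Lemma 40 (seq.) = ToC Lemma 5.16, p. 28; = FSS14 arXiv:1309.5668 Thm. 28] -/
theorem FSV2018_lemma40_holds : FSV2018_lemma40 := by
  intro F _ ι τ τ' _ w d Fm g _ hro hg
  classical
  cases nonempty_fintype ι
  exact FSS2014.isRankConcentrated_of_isCommROABPMatrix (FractionRing (MvPolynomial (τ ⊕ τ') F))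
    (IsFractionRing.injective _ _) Fm g hro hg

end Literature.Computability.AlgebraicComplexity
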